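/-
Copyright (c) 2026 the pub-hodgecm-mathlib formalisation cell (harness21).  Prover seat hodgecm-mathlib-A-p03 (g25): the GENERIC θ̄ = 1 value of the line's type-(1)
stubs `stub_splitGValue2∕3∕4` («N7nsCount» ED. 1.5 :386∕:489∕:593) in the stub frame, UNCONDITIONAL — architect A-p06 (g26), LEAD F0P3a-plan (g9) map of record
T8-122 (3); inputs ★ p841906 (F0P3a-p04 (g12)), ★ `…ThetaOneAdicCompletion` (this seat), the plug of ★ `UnitFundamentalLemmaInertSplitValueOne` (p04) cloned.
-/
import Literature.NumberTheory.Rogawski1990.UnitOrbitalIntegralValueOfCongr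
import Literature.NumberTheory.Rogawski1990.UnitOrbitalIntegralInertValueThetaOneAdicCompletion
import Literature.NumberTheory.Rogawski1990.UnitFundamentalLemmaInertFlickerRepresentatives
import Literature.NumberTheory.Rogawski1990.UnitFundamentalLemmaInertFlickerFrame
import Literature.NumberTheory.Automorphic.UnitOrbitalIntegralFixedPoints
import Literature.NumberTheory.Automorphic.AdicCompletionIntegersAdicComplete                -- ★ p842102: `IsAdicComplete 𝓂[𝒪_w] 𝒪_w`
import HarnessLib

/-!
# The θ̄ = 1 type-(1) values `X₂, X₃, X₄ = φ₁(·,·)` of the line «N7nsCount» in the stub frame — ONE generic theorem over an abstract norm-one triple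
# (Flicker 1998 Prop. 11, Props. 12–13; Rogawski 1990 Prop. 4.9.1 (b))

Topic `NumberTheory/Rogawski1990`; namespace `Literature.NumberTheory.Rogawski1990`.  THEOREMS ONLY (no definition, no instance, no notation, no named fact, no `sorry`);
kernel lane.  HONEST LABEL: HC_CM is proved only modulo the printed citations until rung 0 closes.

**`classOrbitalIntegral_indicator_flickerTorusElt_eq_phiOne_of_congr`**: in the frame of the line's composition (`H′` hermitian invertible, `w ∣ v` with `c • w = w`,
`v` unramified, `2 ∈ 𝒪_w^×`, canonical orbital measures `mG` with mass-one level), for ANY `t ∈ G′_v` carried by a level-preserving congruence `ψ g = Tl g Tl⁻¹` to Flicker's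
torus literal `t_π(x₁, x₂, x₃) = !![e(x₁+x₃), 0, −e(x₁−x₃)π; 0, x₂, 0; −e(x₁−x₃)π′, 0, e(x₁+x₃)]` over `E_v` — `2e = 1`, `x₁, x₂, x₃` pairwise distinct of norm one, `π` Flicker's
scalar (`σπ = π`, `ππ′ = 1`, not a norm) — one has `Φ(⟦t⟧, 1_{K′}) = φ₁(Q₁, P)` with `|x₁ − x₃|_w = q^{−P}`, `|x₁ − x₂|_w = q^{−Q₁}` (`q = Nv`), UNCONDITIONALLY (the `𝔪`-adic completeness
of `𝒪_w` needed by the abstract counting files is ★ `isAdicComplete_maximalIdeal_valuedInteger_adicCompletion`, p842102 — as in ★ `…_eq_phiZero_of_congr'`).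
PROOF = p04's X₁ plug with two changes: the eigenframe is `P_π = !![π,0,π;0,1,0;−1,0,1]` (★ `flickerTorusElt_mul_frame h2e hππ′`, explicit inverse
`!![eπ′,0,−e;0,1,0;eπ′,0,e]`), and Flicker's scalar is read at `w` (`σ_w π_w = π_w`, `π_w π′_w = 1`, `π_w` not a norm — `E_v = L_w` at a non-split place, ★
`PlacesOver.subsingleton_of_smul_eq` + `RingEquiv.piUnique`) to feed ★ `natCard_fixedPoints_unitaryInt_corner_eq_phiOne_adicCompletion`.
The three stubs are instantiations: X₂ `(x₁,x₂,x₃) = (a, u, d)` ↦ `φ₁(N₁, N)`; X₃ `(a, d, u)` ↦ `φ₁(N, N₁)`; X₄ `(u, a, d)` ↦ `φ₁(N₁, N₂)` (file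
`UnitFundamentalLemmaInertSplitValuesThetaOne`, stub statements verbatim).

## References
* [Flicker1998UnitaryFL] Y. Z. Flicker, *Elementary proof of the fundamental lemma for a unitary group*, Canad. J. Math. 50 (1998): Prop. 3 p. 79, Prop. 11 p. 87, Props. 12–13
  pp. 89–94, §6 p. 95.
* [Rogawski1990] J. D. Rogawski, *Automorphic Representations of Unitary Groups in Three Variables* (1990), §4.9 Prop. 4.9.1 (b) p. 55, §14.2 p. 233.
-/

set_option autoImplicit false

noncomputable section

open MeasureTheory Measure Set Function NumberField IsDedekindDomain Matrix Polynomial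
open Literature.NumberTheory.Automorphic Literature.NumberTheory.Automorphic.UnitaryGroup
open Literature.NumberTheory.Automorphic.IntegralReduction Literature.NumberTheory.GaloisRepresentations
open scoped Matrix MatrixGroups ValuativeRel

namespace Literature.NumberTheory.Rogawski1990

section ValueThetaOne

variable (L : Type) [Field L] [NumberField L] [IsCMField L] (H' : Matrix (Fin 3) (Fin 3) L)
  {v : HeightOneSpectrum (𝓞 ↥(maximalRealSubfield L))}

/-- Flicker's frame `P_θ = [[θ,0,θ],[0,1,0],[−1,0,1]]` times `[[eθ′,0,−e],[0,1,0],[eθ′,0,e]]` is `1` when `2e = 1`, `θθ′ = 1` (generic ring; instantiated at `E_v`).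
[cite: Flicker1998UnitaryFL, §2 Prop. 3 p. 79] -/
private theorem flickerFrame_mul_inv_eq_one {R : Type*} [CommRing R] {e θ θ' : R} (h2e : 2 * e = 1) (hθ : θ * θ' = 1) :
    !![θ, 0, θ; 0, 1, 0; -1, 0, 1] * !![e * θ', 0, -e; 0, 1, 0; e * θ', 0, e] = 1 := by
  ext i j
  fin_cases i <;> fin_cases j <;> simp [Matrix.mul_apply, Fin.sum_univ_three] <;> grind

/-- The same product in the other order. [cite: Flicker1998UnitaryFL, §2 Prop. 3 p. 79] -/
private theorem inv_mul_flickerFrame_eq_one {R : Type*} [CommRing R] {e θ θ' : R} (h2e : 2 * e = 1) (hθ : θ * θ' = 1) :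
    !![e * θ', 0, -e; 0, 1, 0; e * θ', 0, e] * !![θ, 0, θ; 0, 1, 0; -1, 0, 1] = 1 := by
  ext i j
  fin_cases i <;> fin_cases j <;> simp [Matrix.mul_apply, Fin.sum_univ_three] <;> grind

set_option synthInstance.maxHeartbeats 200000 in  -- the coset action `U_w ↷ U_w ⧸ unitaryInt` (as in ★ `FixedCosetsTransport`)
/-- **THE GENERIC θ̄ = 1 VALUE IN THE STUB FRAME (unconditional)**: `Φ(⟦t⟧, 1_{K′}) = φ₁(Q₁, P)` for any `t ∈ G′_v` carried by a level-preserving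
congruence to Flicker's `t_π(x₁, x₂, x₃)` (`x_i` pairwise distinct of norm one, `π` Flicker's non-norm scalar), `P = ord_w(x₁ − x₃)`, `Q₁ = ord_w(x₁ − x₂)`.
[cite: Flicker1998UnitaryFL, Prop. 11 p. 87; Props. 12–13 pp. 89–94; §6 p. 95] [cite: Rogawski1990, §4.9 Prop. 4.9.1 (b) p. 55] -/
theorem classOrbitalIntegral_indicator_flickerTorusElt_eq_phiOne_of_congr
    (hH' : (H'.map (IsCMField.complexConj L))ᵀ = H') (hH'u : IsUnit H') (w : PlacesOver L v)
    (hw : IsCMField.complexConj L • w.1 = w.1) (hv : Algebra.IsUnramifiedIn (𝓞 L) v.asIdeal)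
    [MeasurableSpace ((cmDatum L 3 H').Local v)] [BorelSpace ((cmDatum L 3 H').Local v)]
    [∀ γ : ((cmDatum L 3 H').Local v), MeasurableSpace (((cmDatum L 3 H').Local v) ⧸ Subgroup.centralizer ({γ} : Set ((cmDatum L 3 H').Local v)))]
    [∀ γ : ((cmDatum L 3 H').Local v), BorelSpace (((cmDatum L 3 H').Local v) ⧸ Subgroup.centralizer ({γ} : Set ((cmDatum L 3 H').Local v)))]
    (νG : Measure ((cmDatum L 3 H').Local v)) [νG.IsHaarMeasure] [νG.IsMulRightInvariant]
    {mG : OrbitalMeasureFamily ((cmDatum L 3 H').Local v)}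
    (hmG : mG.IsCanonical (fun γ => IsRegularElt (γ.val : GL (Fin 3) (UnitaryGroup.LocalRing L v))) νG)
    (hνG : νG (cmLocalIntegralLevel L 3 H' v : Set ((cmDatum L 3 H').Local v)) = 1)
    (h2 : IsUnit (2 : 𝒪[w.1.adicCompletion L]))
    {e π π' y x₁ x₂ x₃ : LocalRing L v} (h2e : 2 * e = 1) (hσπ : conjLocal L (IsCMField.complexConj L) v π = π) (hππ : π * π' = 1)
    (hπN : ∀ z : LocalRing L v, conjLocal L (IsCMField.complexConj L) v z * z ≠ π)
    (hy : conjLocal L (IsCMField.complexConj L) v y * y = -2)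
    (hx₁ : conjLocal L (IsCMField.complexConj L) v x₁ * x₁ = 1) (hx₂ : conjLocal L (IsCMField.complexConj L) v x₂ * x₂ = 1)
    (hx₃ : conjLocal L (IsCMField.complexConj L) v x₃ * x₃ = 1) (h₁₂ : x₁ ≠ x₂) (h₂₃ : x₂ ≠ x₃) (h₁₃ : x₁ ≠ x₃)
    (Tl : GL (Fin 3) (LocalRing L v))
    (ψ : ↥(UnitaryGroup.«local» L (IsCMField.complexConj L) 3 H' v) ≃ₜ*
        ↥(UnitaryGroup.«local» L (IsCMField.complexConj L) 3 (Matrix.of fun i j : Fin 3 => if i.val + j.val + 1 = 3 then (1 : L) else 0) v))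
    (t : (cmDatum L 3 H').Local v)
    (hψ : ∀ g, (ψ g).val = Tl * g.val * Tl⁻¹)
    (hlev : ∀ g, g ∈ cmLocalIntegralLevel L 3 H' v ↔
        ψ g ∈ cmLocalIntegralLevel L 3 (Matrix.of fun i j : Fin 3 => if i.val + j.val + 1 = 3 then (1 : L) else 0) v)
    (hlit : (ψ t).val.val =
          !![e * (x₁ + x₃), 0, -(e * (x₁ - x₃) * π); 0, x₂, 0; -(e * (x₁ - x₃) * π'), 0, e * (x₁ + x₃)])
    {P Q₁ Q₂ : ℕ} (hP : Valued.v (x₁ w - x₃ w) = WithZero.exp (-(P : ℤ))) (hQ₁ : Valued.v (x₁ w - x₂ w) = WithZero.exp (-(Q₁ : ℤ)))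
    (hQ₂ : Valued.v (x₃ w - x₂ w) = WithZero.exp (-(Q₂ : ℤ))) :
    classOrbitalIntegral mG ((cmLocalIntegralLevel L 3 H' v : Set ((cmDatum L 3 H').Local v)).indicator fun _ => (1 : ℂ)) (ConjClasses.mk t) =
      ((Flicker1998.phiOne (Ideal.absNorm v.asIdeal) Q₁ P : ℚ) : ℂ) := by
  have hc1 : IsCMField.complexConj L ≠ 1 := IsCMField.complexConj_ne_one L
  -- `𝒪_w` is `𝔪`-adically complete (★ p842102)
  haveI : IsAdicComplete (IsLocalRing.maximalIdeal (Valued.integer (w.1.adicCompletion L))) (Valued.integer (w.1.adicCompletion L)) :=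
    isAdicComplete_maximalIdeal_valuedInteger_adicCompletion L w.1
  haveI : Algebra.IsQuadraticExtension ↥(maximalRealSubfield L) L := IsCMField.isQuadraticExtension L
  -- (1) the frame of `t`: `t (Tl⁻¹ P_π) = (Tl⁻¹ P_π) diag(x₁, x₂, x₃)`, `P_π` Flicker's frame with the explicit inverse `[[eπ′,0,−e],[0,1,0],[eπ′,0,e]]`
  have hPinv1 : !![π, 0, π; 0, 1, 0; -1, 0, 1] * !![e * π', 0, -e; 0, 1, 0; e * π', 0, e] = 1 := flickerFrame_mul_inv_eq_one h2e hππ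
  have hPinv2 : !![e * π', 0, -e; 0, 1, 0; e * π', 0, e] * !![π, 0, π; 0, 1, 0; -1, 0, 1] = 1 := inv_mul_flickerFrame_eq_one h2e hππ
  set P₁ : GL (Fin 3) (LocalRing L v) := ⟨_, _, hPinv1, hPinv2⟩ with hP₁def
  have hP₁ : P₁.val = !![π, 0, π; 0, 1, 0; -1, 0, 1] := rfl
  have htval : (t.val.val : Matrix (Fin 3) (Fin 3) (LocalRing L v)) = Tl⁻¹.val * (ψ t).val.val * Tl.val := by
    rw [hψ t, Units.val_mul, Units.val_mul, ← Matrix.mul_assoc, ← Matrix.mul_assoc, ← Units.val_mul, inv_mul_cancel, Units.val_one, Matrix.one_mul,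
      Matrix.mul_assoc, ← Units.val_mul, inv_mul_cancel, Units.val_one, Matrix.mul_one]
  have hQ : (t.val.val : Matrix (Fin 3) (Fin 3) (LocalRing L v)) * (Tl⁻¹ * P₁).val = (Tl⁻¹ * P₁).val * diagonal ![x₁, x₂, x₃] := by
    rw [htval, Units.val_mul, hlit, hP₁, Matrix.mul_assoc, Matrix.mul_assoc, ← Matrix.mul_assoc Tl.val, ← Units.val_mul, mul_inv_cancel, Units.val_one,
      Matrix.one_mul, flickerTorusElt_mul_frame h2e hππ, etaDiag_eq_diagonal, ← Matrix.mul_assoc]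
  have hu : Function.Injective ![x₁, x₂, x₃] := by
    intro i j hij
    fin_cases i <;> fin_cases j
    all_goals first | rfl | (exfalso; revert hij; simp [h₁₂, h₂₃, h₁₃, h₁₂.symm, h₂₃.symm, h₁₃.symm])
  have hu1 : ∀ i, conjLocal L (IsCMField.complexConj L) v (![x₁, x₂, x₃] i) * ![x₁, x₂, x₃] i = 1 := by
    intro i; fin_cases i
    · exact hx₁
    · exact hx₂
    · exact hx₃
  -- (2) the (F12)-side: `Φ(⟦t⟧, 1_{K′}) = ↑#Fix(e(ψ t))`
  rw [classOrbitalIntegral_indicator_eq_natCard_fixedPoints_of_congr L H' hH' hH'u w hw νG hmG hνG ψ hlev t hQ hu hu1]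
  -- (3) the data at `w`
  have h2L : (2 : 𝓞 L) ∉ w.1.asIdeal := by
    have h2w : Valued.v (2 : w.1.adicCompletion L) = 1 := (isUnit_two_integer_iff_valued_eq_one L w.1).1 h2
    have e1 : (algebraMap L (w.1.adicCompletion L)) (algebraMap (𝓞 L) L 2) = 2 := by rw [map_ofNat, map_ofNat]
    rw [← e1] at h2w
    change Valued.v ((algebraMap (𝓞 L) L 2 : L) : w.1.adicCompletion L) = 1 at h2w
    rw [HeightOneSpectrum.valuedAdicCompletion_eq_valuation', HeightOneSpectrum.valuation_of_algebraMap] at h2w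
    exact HeightOneSpectrum.intValuation_eq_one_iff.1 h2w
  have h2F : (2 : 𝓞 ↥(maximalRealSubfield L)) ∉ v.asIdeal := by
    intro hmem
    apply h2L
    have h := congrArg HeightOneSpectrum.asIdeal w.2
    rw [← h] at hmem
    simp only [HeightOneSpectrum.under_asIdeal, Ideal.under_def, Ideal.mem_comap, map_ofNat] at hmem
    exact hmem
  have hσw : ∀ z : LocalRing L v, conjLocal L (IsCMField.complexConj L) v z w = galAdicCompletionMap (L := L) (IsCMField.complexConj L) hw (z w) :=
    fun z => conjLocal_apply_eq_of_smul_eq (IsCMField.complexConj L) hc1 v w hw z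
  have hyw : y w * galAdicCompletionMap (L := L) (IsCMField.complexConj L) hw (y w) = -2 := by
    rw [← hσw, mul_comm]; exact (congrFun hy w : _)
  have hx₁w : galAdicCompletionMap (L := L) (IsCMField.complexConj L) hw (x₁ w) * x₁ w = 1 := by
    rw [← hσw]; exact (congrFun hx₁ w : _)
  have hx₂w : galAdicCompletionMap (L := L) (IsCMField.complexConj L) hw (x₂ w) * x₂ w = 1 := by
    rw [← hσw]; exact (congrFun hx₂ w : _)
  have hx₃w : galAdicCompletionMap (L := L) (IsCMField.complexConj L) hw (x₃ w) * x₃ w = 1 := by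
    rw [← hσw]; exact (congrFun hx₃ w : _)
  have h2ew : 2 * e w = 1 := by
    have := congrFun h2e w; simpa using this
  -- Flicker's scalar read at `w` (`E_v = L_w`: one place above a non-split `v`)
  have hσπw : galAdicCompletionMap (L := L) (IsCMField.complexConj L) hw (π w) = π w := by
    rw [← hσw]; exact (congrFun hσπ w : _)
  have hππw : π w * π' w = 1 := by
    have := congrFun hππ w; simpa using this
  have hπNw : ∀ z : w.1.adicCompletion L, galAdicCompletionMap (L := L) (IsCMField.complexConj L) hw z * z ≠ π w := by
    intro z hz
    haveI : Subsingleton (PlacesOver L v) := PlacesOver.subsingleton_of_smul_eq (IsCMField.complexConj L) hc1 w hw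
    letI : Unique (PlacesOver L v) := uniqueOfSubsingleton w
    let πe : LocalRing L v ≃+* w.1.adicCompletion L := RingEquiv.piUnique fun w' : PlacesOver L v => w'.1.adicCompletion L
    have hz' : πe.symm z w = z := πe.apply_symm_apply z
    refine hπN (πe.symm z) (πe.injective ?_)
    show (conjLocal L (IsCMField.complexConj L) v (πe.symm z) * πe.symm z) w = π w
    rw [Pi.mul_apply, hσw, hz', hz]
  -- the literal read at `w`
  have hte : (((localNonsplitEquiv (IsCMField.complexConj L) (Matrix.of fun i j : Fin 3 => if i.val + j.val + 1 = 3 then (1 : L) else 0) hc1 w hw (ψ t) :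
        unitaryGroupOfForm (galAdicCompletionMap (L := L) (IsCMField.complexConj L) hw)
          (placeForm (Matrix.of fun i j : Fin 3 => if i.val + j.val + 1 = 3 then (1 : L) else 0) w.1)) :
        GL (Fin 3) (w.1.adicCompletion L)) : Matrix (Fin 3) (Fin 3) (w.1.adicCompletion L)) =
      !![e w * (x₁ w + x₃ w), 0, -(e w * (x₁ w - x₃ w) * π w); 0, x₂ w, 0; -(e w * (x₁ w - x₃ w) * π' w), 0, e w * (x₁ w + x₃ w)] := by
    rw [coe_coe_localNonsplitEquiv_apply, hlit]
    ext i j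
    fin_cases i <;> fin_cases j <;> rfl
  -- finiteness of the fixed cosets (elliptic regular `t`)
  have hH'c : (H'.map (cmConjRingHom L))ᵀ = H' := by
    have e1 : H'.map (cmConjRingHom L) = H'.map (IsCMField.complexConj L) := by
      ext i j; simp [Matrix.map_apply, cmConjRingHom_apply]
    rw [e1]; exact hH'
  have hdet : H'.det ≠ 0 := (Matrix.isUnit_iff_isUnit_det _ |>.1 hH'u).ne_zero
  have hreg : IsRegularElt (t.val : GL (Fin 3) (LocalRing L v)) := isRegularElt_of_eigenframe L H' w hw t hQ hu
  haveI : CompactSpace (Subgroup.centralizer ({t} : Set ((cmDatum L 3 H').Local v))) :=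
    compactSpace_centralizer_of_eigenframe_of_smul_eq L w hw H' hH'c hdet t hQ hu hu1
  have hfinG : (MulAction.fixedBy ((cmDatum L 3 H').Local v ⧸ cmLocalIntegralLevel L 3 H' v) t).Finite :=
    finite_fixedBy_quotient_of_isClosed t (cmLocalIntegralLevel L 3 H' v) (isClosed_conjClass_local_of_isRegularElt L 3 H' v hH'c hdet t hreg)
      (isCompact_isOpen_cmLocalIntegralLevel L 3 H' v).2 (isCompact_isOpen_cmLocalIntegralLevel L 3 H' v).1
  have hfin := (finite_fixedBy_cmLocalIntegralLevel_iff_of_congr L H' w hw ψ hlev t).1 hfinG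
  -- (4) the θ̄ = 1 value at `L_w`
  have hX := natCard_fixedPoints_unitaryInt_corner_eq_phiOne_adicCompletion L w hw hv h2F hyw h2ew hx₁w hx₂w hx₃w hσπw hππw hπNw hte hP hQ₁ hQ₂ hfin
  exact_mod_cast congrArg (fun r : ℚ => (r : ℂ)) hX

end ValueThetaOne

end Literature.NumberTheory.Rogawski1990

end
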